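import Literature.NumberTheory.DiophantineApproximation.DilogHermitePade
import HarnessLib

/-!
# Type-I Hermite–Padé forms for `1, Li₁, Li₂` at rational points `x = M/N` — vocabulary

Topic `Literature/NumberTheory/DiophantineApproximation`. The forms `S_n(x)` of
`DilogHermitePade.lean` (`DilogPade.form`) at a rational point `x = M/N` (`1 ≤ M < N`) decompose as
`S_n(M/N) = a_n(x) L₂ + b_n(x) L₁ + c_n(x)` with `a_n(x) = ∑_i A_{n,i} x^{−i}` etc.; clearing the
powers of `M` one gets `M^n S_n(M/N) = a^ℚ_n L₂ + b^ℚ_n L₁ + c^ℚ_n` with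

* `formAQ n N M = ∑_{i ≤ n} A_{n,i} N^i M^{n−i} ∈ ℤ`,
* `formBQ n N M = ∑_{i ≤ n} B_{n,i} N^i M^{n−i} ∈ ℚ`,
* `formCQ n N M = −∑_{i ≤ n} ∑_{k < i} N^k M^{n−k} (A_{n,i}/(i−k)² + B_{n,i}/(i−k)) ∈ ℚ`,

and `lcm(1..3n)·lcm(1..n)²` is still a common denominator of `b^ℚ_n, c^ℚ_n`. At `M = 1` these
are `formA`, `formB`, `formC`. This is the vocabulary for the rational-point case of the linear
independence of `1, Li₁(M/N), Li₂(M/N)` (Nikišin 1979; Hata 1990; David–Hirata-Kohno–Kawashima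
2020, Thm 2.1), valid when `N` is large against `M⁴`. Definitions only; the identities are proved in
the sibling files. (The exponents `n − i`, `n − k` are natural-number subtractions with `i ≤ n`,
`k < i ≤ n` inside the sums, so no truncation occurs.)

References: E. M. Nikišin, Mat. Sb. 109 (1979); M. Hata, J. Math. Pures Appl. 69 (1990);
S. David, N. Hirata-Kohno, M. Kawashima, Moscow J. Comb. Number Th. 9 (2020), Thm 2.1.
-/

noncomputable section

open Finset

namespace Literature.NumberTheory.DiophantineApproximation

namespace DilogPade

/-- The coefficient of `Li₂(M/N)` in `M^n S_n(M/N)`: `∑_{i ≤ n} A_{n,i} N^i M^{n−i} ∈ ℤ`.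
[cite: DavidHirataKohnoKawashima2020, Thm 2.1] -/
def formAQ (n N M : ℕ) : ℤ := ∑ i ∈ range (n + 1), (coefA n i : ℤ) * (N : ℤ) ^ i * (M : ℤ) ^ (n - i)

/-- The coefficient of `Li₁(M/N)` in `M^n S_n(M/N)`: `∑_{i ≤ n} B_{n,i} N^i M^{n−i} ∈ ℚ`.
[cite: DavidHirataKohnoKawashima2020, Thm 2.1] -/
def formBQ (n N M : ℕ) : ℚ := ∑ i ∈ range (n + 1), coefB n i * (N : ℚ) ^ i * (M : ℚ) ^ (n - i)

/-- The constant term of `M^n S_n(M/N)`: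
`−∑_{i ≤ n} ∑_{k < i} N^k M^{n−k} (A_{n,i}/(i−k)² + B_{n,i}/(i−k)) ∈ ℚ`.
[cite: DavidHirataKohnoKawashima2020, Thm 2.1] -/
def formCQ (n N M : ℕ) : ℚ :=
  -∑ i ∈ range (n + 1), ∑ k ∈ range i,
    (N : ℚ) ^ k * (M : ℚ) ^ (n - k) * ((coefA n i : ℚ) / ((i : ℚ) - k) ^ 2 + coefB n i / ((i : ℚ) - k))

/-- At `M = 1` the rational-point coefficient `formAQ` is `formA`. [folklore] -/
theorem formAQ_one (n N : ℕ) : formAQ n N 1 = formA n N := by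
  simp [formAQ, formA]

/-- At `M = 1` the rational-point coefficient `formBQ` is `formB`. [folklore] -/
theorem formBQ_one (n N : ℕ) : formBQ n N 1 = formB n N := by
  simp [formBQ, formB]

/-- At `M = 1` the rational-point constant term `formCQ` is `formC`. [folklore] -/
theorem formCQ_one (n N : ℕ) : formCQ n N 1 = formC n N := by
  simp [formCQ, formC]

end DilogPade

end Literature.NumberTheory.DiophantineApproximation
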